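import Mathlib
import Literature.NumberTheory.LFunctions.LittlewoodCriterion
import Summits.Parity.GeneralizedHardyLittlewood.Theorems.LiouvilleMADCosetDecorrelationStubQuasiRHOfProgressionMean

/-!
# Calibration of the product-form mean stub of line `Sketch` against the quasi-Riemann hypothesis

Stub `stub_quasiRH_of_meanMode` of line `Sketch` (card `gram-split-farey-phase`, ideator 2) of crux
stmt-Parity-13317 (`Summit.Parity.GeneralizedHardyLittlewood.Theses.LiouvilleMAD.CosetDecorrelation`).
The line splits the coset sum `T_j(n,n')` into its rank-one (mean) mode `S(n)S(n')/j`,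
`S(n) = Σ_{m∈(M,2M]} λ(mn+c)`, and the fluctuation mode, and files the hypothesis `MeanMode`:
`|S(n)S(n')/j| ≤ C·M^{3/4+ϑ}`, `ϑ < 1/4`, on the crux's ranges (`1 ≤ n ≠ n' ≤ 2M`,
`j ∈ [⌊√M⌋+1, 2⌊√M⌋+2)`).  We GRADE it: already its instance `c = 2`, `(n,n') = (1,2)`,
`j = ⌊√M⌋+1` forces `ζ(s) ≠ 0` on a half-plane `Re s > θ` with `θ < 3/4` — an open hypothesis
(quasi-RH).  [folklore]  Landau 1899 / Littlewood 1912 / Titchmarsh 1986 §14.25 for the dictionary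
step, which is the tree theorem
`Literature.NumberTheory.LFunctions.quasiRiemannHypothesis_of_mertens_isBigO_holds` (PROVED).

**Proof.**  With `B_M = Σ_{m∈(M,2M]} λ(m+1)`: at `c = 2`, `S(2) = Σ λ(2m+2) = λ(2)·B_M = −B_M`
(complete multiplicativity) and `S(1) = Σ λ(m+2) = B_M + λ(2M+2) − λ(M+2)`, so
`|S(1)S(2)| ≥ |B_M|² − 2|B_M|`; the hypothesis with `j = ⌊√M⌋+1 ≤ 2√M` gives
`|S(1)S(2)| ≤ 2C·M^{5/4+ϑ}`; with `|B_M| ≤ M` this yields `|B_M|² ≤ (2C+2)·M^{5/4+ϑ⁺}`, i.e. the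
dyadic block bound `|B_M| ≤ √(2C+2)·M^θ`, `θ = 5/8 + ϑ⁺/2 ∈ [5/8, 3/4)`.  Then the landed chain of
`stub_quasiRH_of_progressionMean` (p97406): binary descent `quasiRH_liouvilleSum_bound`
(`L(x) ≪ x^θ`), `quasiRH_mertens_natCast_bound` (`M(x) = Σ_d μ(d) L(x/d²) ≪ x^θ`),
`quasiRH_mertens_isBigO`, and the Mertens dictionary.
-/

namespace Summit.Parity.GeneralizedHardyLittlewood.Theorems.CosetDecorrelation.GramSplitFareyPhase

open Finset
open Summit.Parity.GeneralizedHardyLittlewood.Theorems.CosetDecorrelation.FareyLevelMeanCoupling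
  (quasiRH_liouvilleSum_bound quasiRH_mertens_natCast_bound quasiRH_mertens_isBigO)

/-- The progression sum at `c = 2`, `n = 1` is the block sum of `λ(m+2)`. -/
theorem meanMode_sum_one (M : ℕ) :
    ∑ m ∈ Finset.Ioc M (2 * M),
        (ArithmeticFunction.liouville (Int.toNat ((m : ℤ) * ((1 : ℕ) : ℤ) + 2)) : ℝ)
      = ∑ m ∈ Finset.Ioc M (2 * M), (ArithmeticFunction.liouville (m + 2) : ℝ) := by
  refine Finset.sum_congr rfl fun m _ => ?_
  have : Int.toNat ((m : ℤ) * ((1 : ℕ) : ℤ) + 2) = m + 2 := by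
    rw [show ((m : ℤ) * ((1 : ℕ) : ℤ) + 2) = ((m + 2 : ℕ) : ℤ) by push_cast; ring, Int.toNat_natCast]
  rw [this]

/-- The progression sum at `c = 2`, `n = 2` is MINUS the block sum of `λ(m+1)`
(`λ(2m+2) = λ(2)λ(m+1) = −λ(m+1)`). -/
theorem meanMode_sum_two (M : ℕ) :
    ∑ m ∈ Finset.Ioc M (2 * M),
        (ArithmeticFunction.liouville (Int.toNat ((m : ℤ) * ((2 : ℕ) : ℤ) + 2)) : ℝ)
      = -∑ m ∈ Finset.Ioc M (2 * M), (ArithmeticFunction.liouville (m + 1) : ℝ) := by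
  rw [← Finset.sum_neg_distrib]
  refine Finset.sum_congr rfl fun m _ => ?_
  have : Int.toNat ((m : ℤ) * ((2 : ℕ) : ℤ) + 2) = 2 * (m + 1) := by
    rw [show ((m : ℤ) * ((2 : ℕ) : ℤ) + 2) = ((2 * (m + 1) : ℕ) : ℤ) by push_cast; ring,
      Int.toNat_natCast]
  have l2 : ArithmeticFunction.liouville 2 = -1 := by
    rw [ArithmeticFunction.liouville_apply (by norm_num),
      ArithmeticFunction.cardFactors_apply_prime Nat.prime_two]; norm_num
  rw [this, ArithmeticFunction.liouville_apply_mul, l2]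
  push_cast
  ring

/-- The two block sums `Σ_{m∈(M,2M]} λ(m+2)` and `Σ_{m∈(M,2M]} λ(m+1)` differ by the two boundary
terms `λ(2M+2) − λ(M+2)`, hence by at most `2` in absolute value (`M ≥ 1`). -/
theorem meanMode_shift_le (M : ℕ) (hM : 1 ≤ M) :
    |(∑ m ∈ Finset.Ioc M (2 * M), (ArithmeticFunction.liouville (m + 2) : ℝ))
        - ∑ m ∈ Finset.Ioc M (2 * M), (ArithmeticFunction.liouville (m + 1) : ℝ)| ≤ 2 := by
  set g : ℕ → ℝ := fun k => (ArithmeticFunction.liouville (k + 1) : ℝ) with hg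
  have hg1 : ∀ k, |g k| ≤ 1 := fun k => by
    simp only [hg]
    exact_mod_cast Literature.NumberTheory.Sieve.Lichtman2020.abs_liouville_le_one (k + 1)
  -- shift the first sum: Σ_{m∈(M,2M]} λ(m+2) = Σ_{k∈(M+1,2M+1]} g k
  have h1 : ∑ m ∈ Finset.Ioc M (2 * M), (ArithmeticFunction.liouville (m + 2) : ℝ)
      = ∑ k ∈ Finset.Ioc (M + 1) (2 * M + 1), g k := by
    rw [← Finset.map_add_right_Ioc M (2 * M) 1, Finset.sum_map]
    refine Finset.sum_congr rfl fun m _ => ?_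
    simp [hg, add_assoc]
  -- split both at the common part Σ_{k∈(M+1,2M]} g k
  have htop : ∑ k ∈ Finset.Ioc (M + 1) (2 * M + 1), g k
      = ∑ k ∈ Finset.Ioc (M + 1) (2 * M), g k + g (2 * M + 1) :=
    Finset.sum_Ioc_succ_top (by omega) g
  have hbot : ∑ k ∈ Finset.Ioc M (2 * M), g k
      = g (M + 1) + ∑ k ∈ Finset.Ioc (M + 1) (2 * M), g k := by
    rw [← Finset.sum_Ioc_consecutive g (Nat.le_succ M) (by omega : M + 1 ≤ 2 * M),
      Nat.Ioc_succ_singleton, Finset.sum_singleton]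
  have hB : ∑ m ∈ Finset.Ioc M (2 * M), (ArithmeticFunction.liouville (m + 1) : ℝ)
      = ∑ k ∈ Finset.Ioc M (2 * M), g k := rfl
  rw [h1, htop, hB, hbot]
  have e : ∑ k ∈ Finset.Ioc (M + 1) (2 * M), g k + g (2 * M + 1)
      - (g (M + 1) + ∑ k ∈ Finset.Ioc (M + 1) (2 * M), g k) = g (2 * M + 1) - g (M + 1) := by ring
  rw [e]
  calc |g (2 * M + 1) - g (M + 1)| ≤ |g (2 * M + 1)| + |g (M + 1)| := abs_sub _ _
    _ ≤ 1 + 1 := add_le_add (hg1 _) (hg1 _)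
    _ = 2 := by norm_num

/-- The block sum `B_M = Σ_{m∈(M,2M]} λ(m+1)` is trivially at most `M` in absolute value. -/
theorem meanMode_block_le (M : ℕ) :
    |∑ m ∈ Finset.Ioc M (2 * M), (ArithmeticFunction.liouville (m + 1) : ℝ)| ≤ M := by
  calc |∑ m ∈ Finset.Ioc M (2 * M), (ArithmeticFunction.liouville (m + 1) : ℝ)|
      ≤ ∑ m ∈ Finset.Ioc M (2 * M), |(ArithmeticFunction.liouville (m + 1) : ℝ)| :=
        Finset.abs_sum_le_sum_abs _ _
    _ ≤ ∑ _m ∈ Finset.Ioc M (2 * M), (1 : ℝ) :=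
        Finset.sum_le_sum fun m _ => by
          exact_mod_cast Literature.NumberTheory.Sieve.Lichtman2020.abs_liouville_le_one (m + 1)
    _ = M := by
        rw [Finset.sum_const, Nat.card_Ioc, nsmul_eq_mul, mul_one]
        exact_mod_cast (by omega : 2 * M - M = M)

/-- `⌊√M⌋ + 1 ≤ 2√M` for `M ≥ 1` (as reals). -/
theorem meanMode_natSqrt_add_one_le (M : ℕ) (hM : 1 ≤ M) :
    ((Nat.sqrt M + 1 : ℕ) : ℝ) ≤ 2 * Real.sqrt M := by
  have h1 : ((Nat.sqrt M : ℕ) : ℝ) ≤ Real.sqrt M := by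
    rw [Real.le_sqrt (Nat.cast_nonneg _) (Nat.cast_nonneg _)]
    exact_mod_cast Nat.sqrt_le' M
  have h2 : (1 : ℝ) ≤ Real.sqrt M := by
    rw [show (1 : ℝ) = Real.sqrt 1 by simp]
    exact Real.sqrt_le_sqrt (by exact_mod_cast hM)
  push_cast
  linarith

/-- ABSTRACT STEP: from `|S₁·S₂| ≤ K`, `S₂ = −B`, `|S₁ − B| ≤ 2` conclude `|B|² ≤ K + 2|B|`. -/
theorem meanMode_sq_le {S₁ B K : ℝ} (hprod : |S₁ * (-B)| ≤ K) (hshift : |S₁ - B| ≤ 2) :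
    |B| ^ 2 ≤ K + 2 * |B| := by
  have hB : 0 ≤ |B| := abs_nonneg _
  -- |S₁| ≥ |B| - 2
  have hS₁ : |B| - 2 ≤ |S₁| := by
    have := abs_sub_abs_le_abs_sub B S₁
    rw [abs_sub_comm] at this
    linarith
  have hprod' : |S₁| * |B| ≤ K := by
    have : |S₁ * (-B)| = |S₁| * |B| := by rw [abs_mul, abs_neg]
    linarith [this ▸ hprod]
  nlinarith [mul_le_mul_of_nonneg_right hS₁ hB]

/-- **STUB `stub_quasiRH_of_meanMode`** (registered periphery stub of line `Sketch`, crux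
stmt-Parity-13317): the product-form mean hypothesis `MeanMode` of the line — for every `c ≠ 0`
some `ϑ < 1/4` and `C` with `|S(n)S(n')/j| ≤ C·M^{3/4+ϑ}` on the crux's ranges — implies the
quasi-Riemann hypothesis at some abscissa `θ < 3/4`
(`Literature.NumberTheory.LFunctions.QuasiRiemannHypothesis θ`: no zero of `ζ` with
`θ < Re s < 1`).  Only the instance `c = 2`, `(n,n') = (1,2)`, `j = ⌊√M⌋+1` is used. -/
theorem stub_quasiRH_of_meanMode :
    (∀ c : ℤ, c ≠ 0 → ∃ ϑ : ℝ, ϑ < 1 / 4 ∧ ∃ C : ℝ, ∀ M n n' j : ℕ, 1 ≤ n → 1 ≤ n' → n ≠ n' →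
      n ≤ 2 * M → n' ≤ 2 * M → Nat.sqrt M + 1 ≤ j → j < 2 * (Nat.sqrt M + 1) →
        |(∑ m ∈ Finset.Ioc M (2 * M), (ArithmeticFunction.liouville (Int.toNat ((m : ℤ) * n + c)) : ℝ)) *
            (∑ m ∈ Finset.Ioc M (2 * M), (ArithmeticFunction.liouville (Int.toNat ((m : ℤ) * n' + c)) : ℝ)) /
              (j : ℝ)| ≤ C * (M : ℝ) ^ (3 / 4 + ϑ)) →
      ∃ θ : ℝ, θ < 3 / 4 ∧ Literature.NumberTheory.LFunctions.QuasiRiemannHypothesis θ := by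
  intro h
  obtain ⟨ϑ, hϑ, C, hC⟩ := h 2 two_ne_zero
  -- exponents
  set ϑ' : ℝ := max ϑ 0 with hϑ'
  have hϑ'0 : 0 ≤ ϑ' := le_max_right _ _
  have hϑ'4 : ϑ' < 1 / 4 := max_lt hϑ (by norm_num)
  have hϑϑ' : ϑ ≤ ϑ' := le_max_left _ _
  set θ : ℝ := 5 / 8 + ϑ' / 2 with hθ
  have hθ0 : 0 < θ := by linarith
  have hθ1 : θ ≤ 1 := by linarith
  have hθ34 : θ < 3 / 4 := by linarith
  have h2θ : (2 : ℝ) * θ = 5 / 4 + ϑ' := by rw [hθ]; ring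
  -- constants
  set C₀ : ℝ := max C 0 with hC₀
  have hC₀0 : 0 ≤ C₀ := le_max_right _ _
  have hCC₀ : C ≤ C₀ := le_max_left _ _
  set D : ℝ := Real.sqrt (2 * C₀ + 2) with hD
  have hD0 : 0 ≤ D := Real.sqrt_nonneg _
  -- the dyadic block bound for `λ(m+1)`
  have hb : ∀ M : ℕ, 1 ≤ M →
      |∑ m ∈ Finset.Ioc M (2 * M), (ArithmeticFunction.liouville (m + 1) : ℝ)| ≤ D * (M : ℝ) ^ θ := by
    intro M hM
    have hMr : (1 : ℝ) ≤ M := by exact_mod_cast hM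
    have hMpos : (0 : ℝ) < M := by linarith
    set B : ℝ := ∑ m ∈ Finset.Ioc M (2 * M), (ArithmeticFunction.liouville (m + 1) : ℝ) with hBdef
    -- the instance c = 2, (n,n') = (1,2), j = ⌊√M⌋+1 of the hypothesis
    have hinst := hC M 1 2 (Nat.sqrt M + 1) le_rfl (by norm_num) (by norm_num) (by omega) (by omega)
      le_rfl (by omega)
    rw [meanMode_sum_one, meanMode_sum_two] at hinst
    -- |S₁ · (−B)| ≤ C j M^{3/4+ϑ} ≤ 2 C₀ M^{5/4+ϑ'}
    have hjpos : (0 : ℝ) < ((Nat.sqrt M + 1 : ℕ) : ℝ) := by positivity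
    have hpow : 0 ≤ (M : ℝ) ^ (3 / 4 + ϑ) := Real.rpow_nonneg hMpos.le _
    have hK : |(∑ m ∈ Finset.Ioc M (2 * M), (ArithmeticFunction.liouville (m + 2) : ℝ)) * (-B)|
        ≤ 2 * C₀ * (M : ℝ) ^ (5 / 4 + ϑ') := by
      have e1 : |(∑ m ∈ Finset.Ioc M (2 * M), (ArithmeticFunction.liouville (m + 2) : ℝ)) * (-B)|
          ≤ C * (M : ℝ) ^ (3 / 4 + ϑ) * ((Nat.sqrt M + 1 : ℕ) : ℝ) := by
        have := hinst
        rw [abs_div, Nat.abs_cast, div_le_iff₀ hjpos] at this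
        exact this
      have e2 : C * (M : ℝ) ^ (3 / 4 + ϑ) * ((Nat.sqrt M + 1 : ℕ) : ℝ)
          ≤ C₀ * (M : ℝ) ^ (3 / 4 + ϑ) * (2 * Real.sqrt M) := by
        have h1 : C * (M : ℝ) ^ (3 / 4 + ϑ) ≤ C₀ * (M : ℝ) ^ (3 / 4 + ϑ) :=
          mul_le_mul_of_nonneg_right hCC₀ hpow
        have h2 : 0 ≤ C₀ * (M : ℝ) ^ (3 / 4 + ϑ) := mul_nonneg hC₀0 hpow
        calc C * (M : ℝ) ^ (3 / 4 + ϑ) * ((Nat.sqrt M + 1 : ℕ) : ℝ)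
            ≤ C₀ * (M : ℝ) ^ (3 / 4 + ϑ) * ((Nat.sqrt M + 1 : ℕ) : ℝ) :=
              mul_le_mul_of_nonneg_right h1 hjpos.le
          _ ≤ C₀ * (M : ℝ) ^ (3 / 4 + ϑ) * (2 * Real.sqrt M) :=
              mul_le_mul_of_nonneg_left (meanMode_natSqrt_add_one_le M hM) h2
      have e3 : (M : ℝ) ^ (3 / 4 + ϑ) * Real.sqrt M = (M : ℝ) ^ (5 / 4 + ϑ) := by
        rw [Real.sqrt_eq_rpow, ← Real.rpow_add hMpos, show (3 / 4 + ϑ + 1 / 2 : ℝ) = 5 / 4 + ϑ by ring]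
      have e4 : (M : ℝ) ^ (5 / 4 + ϑ) ≤ (M : ℝ) ^ (5 / 4 + ϑ') :=
        Real.rpow_le_rpow_of_exponent_le hMr (by linarith)
      calc |(∑ m ∈ Finset.Ioc M (2 * M), (ArithmeticFunction.liouville (m + 2) : ℝ)) * (-B)|
          ≤ C₀ * (M : ℝ) ^ (3 / 4 + ϑ) * (2 * Real.sqrt M) := e1.trans e2
        _ = 2 * C₀ * ((M : ℝ) ^ (3 / 4 + ϑ) * Real.sqrt M) := by ring
        _ = 2 * C₀ * (M : ℝ) ^ (5 / 4 + ϑ) := by rw [e3]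
        _ ≤ 2 * C₀ * (M : ℝ) ^ (5 / 4 + ϑ') :=
            mul_le_mul_of_nonneg_left e4 (by positivity)
    -- |B|² ≤ 2 C₀ M^{5/4+ϑ'} + 2|B| ≤ (2 C₀ + 2) M^{5/4+ϑ'}
    have hsq : |B| ^ 2 ≤ 2 * C₀ * (M : ℝ) ^ (5 / 4 + ϑ') + 2 * |B| :=
      meanMode_sq_le hK (meanMode_shift_le M hM)
    have hBM : |B| ≤ (M : ℝ) ^ (5 / 4 + ϑ') := by
      calc |B| ≤ (M : ℝ) := meanMode_block_le M
        _ = (M : ℝ) ^ (1 : ℝ) := (Real.rpow_one _).symm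
        _ ≤ (M : ℝ) ^ (5 / 4 + ϑ') := Real.rpow_le_rpow_of_exponent_le hMr (by linarith)
    have hsq' : |B| ^ 2 ≤ (2 * C₀ + 2) * (M : ℝ) ^ (5 / 4 + ϑ') := by nlinarith
    -- take square roots
    have hrhs : (2 * C₀ + 2) * (M : ℝ) ^ (5 / 4 + ϑ') = (D * (M : ℝ) ^ θ) ^ 2 := by
      rw [mul_pow, hD, Real.sq_sqrt (by positivity), ← Real.rpow_natCast ((M : ℝ) ^ θ) 2,
        ← Real.rpow_mul hMpos.le, Nat.cast_ofNat, mul_comm θ 2, h2θ]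
    rw [hrhs] at hsq'
    have hDM : 0 ≤ D * (M : ℝ) ^ θ := mul_nonneg hD0 (Real.rpow_nonneg hMpos.le _)
    have hfin := abs_le_of_sq_le_sq hsq' hDM
    rwa [abs_abs] at hfin
  -- summatory Liouville, Mertens at naturals, big-O, dictionary
  obtain ⟨E, hE0, hE⟩ := quasiRH_liouvilleSum_bound hθ0 hθ1 hD0 hb
  obtain ⟨F, hF0, hF⟩ := quasiRH_mertens_natCast_bound (by linarith : 1 / 2 < θ) hE0 hE
  have hO := quasiRH_mertens_isBigO hθ0.le hF0 hF
  exact ⟨θ, hθ34,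
    Literature.NumberTheory.LFunctions.quasiRiemannHypothesis_of_mertens_isBigO_holds θ hθ0
      (by linarith) hO⟩

end Summit.Parity.GeneralizedHardyLittlewood.Theorems.CosetDecorrelation.GramSplitFareyPhase
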